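import Summits.BirchSwinnertonDyer.BirchSwinnertonDyer.Theorems.ManinLocalTwoThreeKummerDiamondStepTwoKummerSubgroup
import Summits.BirchSwinnertonDyer.BirchSwinnertonDyer.Theorems.ManinLocalTwoThreeIndexFourFullTwoTorsion
import HarnessLib

/-!
# es's STEP 1–2, residual input (T2) DISCHARGED: in the index-`4` world every `2`-torsion point of `W₀(ℂ)` is fixed by `Aut(ℂ/ℚ)` (modulo F★ ∧ CES)
(route `ManinLocalTwoThree`, crux C2 `ManinOddAtFour` stmt-BirchSwinnertonDyer-22967; cell bsd-f2-manin, prover p2 gen 21; hypothesis `hfix2` of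
`StepTwo.propositionA_of_reciprocity`; E-an-152d = p757495 `indexFourForcesFullRationalTwoTorsion_of_cuspRational_CES`; `--supports stmt-BirchSwinnertonDyer-22967`)

* `nonsingular_baseChange_of_equation` / `map_some_ratCast` / `two_nsmul_some_eq_zero` — a rational solution `(x, y)` of the Weierstrass equation with
  `2y + a₁x + a₃ = 0` gives a point of `W₀(ℂ)` killed by `2` and fixed by every `σ : ℂ ≃ₐ[ℚ] ℂ`;
* **`twoTorsion_fixed_of_index_four`** — for a lattice-optimal `X₀(N)`-datum with `4 ∣ N` and `Λ₁ = 2Λ₀`: the three rational `2`-torsion abscissae of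
  E-an-152d give, with `O`, four distinct `Aut(ℂ/ℚ)`-fixed points killed by `2`; as `|W₀(ℂ)[2]| ≤ 4` (`ncard_twoTorsion_le_four`) these are all of
  `W₀(ℂ)[2]`.  CONDITIONAL on the printed facts F★ (`optimalGamma1Parametrization_cusp_rational`) and CES (`exists_optimal_gamma1ParametrizationData`).
Nothing about E-es-185, C2, Manin's conjecture or BSD is proved.  No definitions, no sorry. [cite: ConradEdixhovenStein2003, §6.1.2 and §6.2] [cite: Stevens1989, §2]
[cite: SilvermanAEC2009, Prop. X.1.4]
-/

set_option autoImplicit false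
-- lint-debt: the directory name repeats the summit name (sibling precedent `ManinLocalTwoThreeKummerDiamondStepTwoKummerSubgroup.lean`)
set_option linter.dupNamespace false

noncomputable section

open scoped MatrixGroups
open CongruenceSubgroup WeierstrassCurve Literature.NumberTheory.EllipticCurves Literature.NumberTheory.EllipticCurves.ModularForms
open Literature.NumberTheory.EllipticCurves.Greenberg1999

namespace Summit.BirchSwinnertonDyer.BirchSwinnertonDyer.Theorems.ManinLocalTwoThree.StepTwo

variable {W₀ : WeierstrassCurve ℚ} [W₀.IsElliptic]

/-- A rational solution of the Weierstrass equation is a nonsingular point over `ℂ`. [folklore] -/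
theorem nonsingular_baseChange_of_equation {x y : ℚ} (h : W₀.toAffine.Equation x y) :
    (W₀.baseChange ℂ).toAffine.Nonsingular (x : ℂ) (y : ℂ) := by
  haveI : (W₀.baseChange ℂ).IsElliptic := by rw [WeierstrassCurve.baseChange]; infer_instance
  have h' : (W₀.baseChange ℂ).toAffine.Equation (algebraMap ℚ ℂ x) (algebraMap ℚ ℂ y) := Affine.Equation.map (algebraMap ℚ ℂ) h
  exact ((W₀.baseChange ℂ).toAffine.equation_iff_nonsingular).mp h'

omit [W₀.IsElliptic] in
/-- Points with equal coordinates are equal. [folklore] -/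
theorem some_congr {x y x' y' : ℂ} (h : (W₀.baseChange ℂ).toAffine.Nonsingular x y) (h' : (W₀.baseChange ℂ).toAffine.Nonsingular x' y')
    (hx : x = x') (hy : y = y') : Affine.Point.some _ _ h = Affine.Point.some _ _ h' := by
  subst hx hy; rfl

omit [W₀.IsElliptic] in
/-- **Points with rational coordinates are fixed by `Aut(ℂ/ℚ)`.** [folklore] -/
theorem map_some_ratCast {x y : ℚ} (h : (W₀.baseChange ℂ).toAffine.Nonsingular (x : ℂ) (y : ℂ)) (σ : ℂ ≃ₐ[ℚ] ℂ) :
    Affine.Point.map (W' := W₀) (σ : ℂ →ₐ[ℚ] ℂ) (Affine.Point.some _ _ h) = Affine.Point.some _ _ h := by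
  rw [Affine.Point.map_some]
  exact some_congr _ _ (by simp) (by simp)

omit [W₀.IsElliptic] in
/-- A point `(x, y)` with `2y + a₁x + a₃ = 0` is killed by `2`. [cite: SilvermanAEC2009, III.2.3] -/
theorem two_nsmul_some_eq_zero {x y : ℚ} (h : (W₀.baseChange ℂ).toAffine.Nonsingular (x : ℂ) (y : ℂ)) (ht : 2 * y + W₀.a₁ * x + W₀.a₃ = 0) :
    (2 : ℕ) • Affine.Point.some _ _ h = 0 := by
  rw [two_nsmul]
  refine Affine.Point.add_self_of_Y_eq ?_
  change (y : ℂ) = -(y : ℂ) - algebraMap ℚ ℂ W₀.a₁ * x - algebraMap ℚ ℂ W₀.a₃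
  rw [eq_ratCast, eq_ratCast]
  have h' : ((2 * y + W₀.a₁ * x + W₀.a₃ : ℚ) : ℂ) = 0 := by rw [ht]; push_cast; rfl
  push_cast at h'
  linear_combination h'

variable {N : ℕ} [NeZero N]

/-- **(T2) In the index-`4` world every `2`-torsion point of `W₀(ℂ)` is fixed by `Aut(ℂ/ℚ)`** (modulo F★ ∧ CES).
[cite: ConradEdixhovenStein2003, §6.1.2 and §6.2] [cite: Stevens1989, §2] -/
theorem twoTorsion_fixed_of_index_four (hF : optimalGamma1Parametrization_cusp_rational) (hCES : exists_optimal_gamma1ParametrizationData)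
    [W₀.IsGloballyMinimal] (D₀ : ModularParametrizationData W₀ N) (hopt : ∀ z ∈ D₀.L.lattice, ∃ w ∈ periodLattice D₀.f, z = D₀.c * w)
    (hN4 : 2 ^ 2 ∣ N) (h4 : ∀ z : ℂ, z ∈ periodLatticeGamma1 D₀.f ↔ ∃ w ∈ periodLattice D₀.f, z = 2 * w)
    (S : (W₀.baseChange ℂ).toAffine.Point) (hS : 2 • S = 0) (σ : ℂ ≃ₐ[ℚ] ℂ) :
    Affine.Point.map (W' := W₀) (σ : ℂ →ₐ[ℚ] ℂ) S = S := by
  obtain ⟨x₁, x₂, x₃, h12, h13, h23, ⟨y₁, he₁, ht₁⟩, ⟨y₂, he₂, ht₂⟩, ⟨y₃, he₃, ht₃⟩⟩ :=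
    IndexFourTwoTorsion.indexFourForcesFullRationalTwoTorsion_of_cuspRational_CES hF hCES W₀ D₀ hopt hN4 h4
  have hn₁ := nonsingular_baseChange_of_equation he₁
  have hn₂ := nonsingular_baseChange_of_equation he₂
  have hn₃ := nonsingular_baseChange_of_equation he₃
  set T₁ := Affine.Point.some _ _ hn₁ with hT₁
  set T₂ := Affine.Point.some _ _ hn₂ with hT₂
  set T₃ := Affine.Point.some _ _ hn₃ with hT₃
  -- the four-set `{0, T₁, T₂, T₃}` is all of `W₀(ℂ)[2]`
  have hne : ∀ {a b c d : ℚ} (ha : (W₀.baseChange ℂ).toAffine.Nonsingular (a : ℂ) (b : ℂ))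
      (hc : (W₀.baseChange ℂ).toAffine.Nonsingular (c : ℂ) (d : ℂ)), a ≠ c → Affine.Point.some _ _ ha ≠ Affine.Point.some _ _ hc := by
    intro a b c d ha hc hac h
    rw [Affine.Point.some.injEq] at h
    exact hac (by exact_mod_cast h.1)
  have hsub : ({0, T₁, T₂, T₃} : Set (W₀.baseChange ℂ).toAffine.Point) ⊆ {S | 2 • S = 0} := by
    intro P hP
    simp only [Set.mem_insert_iff, Set.mem_singleton_iff] at hP
    rcases hP with rfl | rfl | rfl | rfl
    · exact (nsmul_zero 2 : (2 : ℕ) • (0 : (W₀.baseChange ℂ).toAffine.Point) = 0)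
    · exact two_nsmul_some_eq_zero hn₁ ht₁
    · exact two_nsmul_some_eq_zero hn₂ ht₂
    · exact two_nsmul_some_eq_zero hn₃ ht₃
  have hcard : ({0, T₁, T₂, T₃} : Set (W₀.baseChange ℂ).toAffine.Point).ncard = 4 := by
    rw [Set.ncard_insert_of_notMem (by
          simp only [Set.mem_insert_iff, Set.mem_singleton_iff, not_or]
          exact ⟨(Affine.Point.some_ne_zero hn₁).symm, (Affine.Point.some_ne_zero hn₂).symm, (Affine.Point.some_ne_zero hn₃).symm⟩),
      Set.ncard_insert_of_notMem (by
          simp only [Set.mem_insert_iff, Set.mem_singleton_iff, not_or]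
          exact ⟨hne hn₁ hn₂ h12, hne hn₁ hn₃ h13⟩),
      Set.ncard_pair (hne hn₂ hn₃ h23)]
  obtain ⟨hfin, hle⟩ := ncard_twoTorsion_le_four D₀
  have heq : ({0, T₁, T₂, T₃} : Set (W₀.baseChange ℂ).toAffine.Point) = {S | 2 • S = 0} :=
    Set.eq_of_subset_of_ncard_le hsub (by rw [hcard]; exact hle) hfin
  have hS' : S ∈ ({0, T₁, T₂, T₃} : Set (W₀.baseChange ℂ).toAffine.Point) := by rw [heq]; exact hS
  simp only [Set.mem_insert_iff, Set.mem_singleton_iff] at hS'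
  rcases hS' with rfl | rfl | rfl | rfl
  · exact map_zero _
  · exact map_some_ratCast hn₁ σ
  · exact map_some_ratCast hn₂ σ
  · exact map_some_ratCast hn₃ σ

end Summit.BirchSwinnertonDyer.BirchSwinnertonDyer.Theorems.ManinLocalTwoThree.StepTwo

end
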